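import Mathlib.Analysis.ODE.ExistUnique
import HarnessLib

/-!
# Global existence for ordinary differential equations from an a priori bound

Trunk: analysis / ODE. Mathlib (this pin) has the *local* Picard–Lindelöf theorem
(`IsPicardLindelof.exists_eq_forall_mem_Icc_hasDerivWithinAt`: a time-dependent vector field that
is Lipschitz on a ball, continuous in time and bounded there has an integral curve on a time
interval of length `≍ radius / bound`) and uniqueness (`ODE_solution_unique_of_mem_Icc_right`), but
no continuation / global-existence statement (searched `IsPicardLindelof`, `maximal`, `global` in
`Mathlib/Analysis/ODE`: none). This file proves the classical **continuation principle in its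
a-priori-bound form** (Teschl 2012, Cor. 2.15–2.16, PDF p. 63–64: "if `T₊ < ∞` then the solution
must eventually leave every compact set"; Hale 1980, Ch. I, Thm. 2.1; Hartman 1964, Ch. II, Thm. 3.1;
Robinson–Rodrigo–Sadowski 2016, proof of Thm. 4.4, Step 1: "the Galerkin system ... has a unique
`C¹` solution on some interval `[0, T_n)` ... the energy estimate shows it cannot blow up, so
`T_n = ∞`"): if the vector field is Lipschitz on every ball uniformly for `t` in compact time
intervals and continuous in `t`, and every solution issued from `x₀` on every `[0, s] ⊆ [0, T]`
stays in a fixed ball `‖x‖ ≤ R(T)`, then there is a solution on `[0, ∞)`.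

## Contents (all proved)

Solutions on a closed interval `[a, b]` are taken in the output convention of Mathlib's
Picard–Lindelöf theorem, `∀ t ∈ Icc a b, HasDerivWithinAt α (v t (α t)) (Icc a b) t` (one-sided
derivatives at the endpoints), which is Mathlib's `IsIntegralCurveOn α v (Icc a b)` unfolded (its
API, e.g. `IsIntegralCurveOn.continuousOn`, `IsIntegralCurveOn.mono`, applies verbatim); no new
definition is introduced.

* `ODE.solution_mono`, `ODE.solution_congr`, `ODE.solution_const`, `ODE.solution_append` —
  restriction, transport along equality on the interval, constants on `[a, a]`, and **gluing** of a
  solution on `[a, b]` with one on `[b, c]` agreeing at `b` (`HasDerivWithinAt.union`).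
* `ODE.solution_extend` — **continuation with uniform steps**: a solution on `[a, b]` extends
  to `[a, T]` provided the field is `K`-Lipschitz and bounded by `L` on the ball `‖x‖ ≤ R + 1` for
  `t ∈ [a, T]`, continuous in `t`, and all continuations obey the a priori bound `‖β t‖ ≤ R`
  (Picard–Lindelöf on `⌈(T - b)(L + 1)⌉` consecutive intervals of length `1/(L+1)`).
* `ODE.exists_solution_of_apriori_bound`, `ODE.exists_solution_Ici_of_apriori_bound` — **global
  existence on `[0, ∞)`** from a priori bounds on every finite horizon (nested continuations on
  `[0, m]`, `m ∈ ℕ`), and its unpacked form (continuity on `[0, ∞)`, `HasDerivAt` for `t > 0`,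
  right derivative at `0`).

## References

* J. K. Hale, *Ordinary Differential Equations*, 2nd ed. (Krieger 1980), Ch. I, Thm. 2.1, Lemma 2.1.
* P. Hartman, *Ordinary Differential Equations* (Wiley 1964), Ch. II, Thm. 1.1, Thm. 3.1.
* G. Teschl, *Ordinary Differential Equations and Dynamical Systems*, GSM 140 (AMS 2012), Thm. 2.2
  (Picard–Lindelöf), Lemma 2.14, Cor. 2.15, Cor. 2.16, Thm. 2.17 (PDF pp. 62–64). [Teschl2012]
* J. C. Robinson, J. L. Rodrigo, W. Sadowski, *The three-dimensional Navier–Stokes equations*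
  (CUP 2016), proof of Thm. 4.4, Step 1.
-/

noncomputable section

open Set Metric Filter Topology

open scoped NNReal

namespace Literature.Analysis.ODE

variable {E : Type*} [NormedAddCommGroup E] [NormedSpace ℝ E]

/-! ## Solutions on closed intervals

A solution of `α' = v(t, α)` on `[a, b]` means `∀ t ∈ Icc a b, HasDerivWithinAt α (v t (α t)) (Icc a b) t`
(Hale 1980, Ch. I, §I.1; Teschl 2012, §2.2), written out in every statement. -/

section Solutions

variable {v : ℝ → E → E} {a b c : ℝ} {α β : ℝ → E}

/-- Restriction of a solution on `[a, b]` to a closed subinterval `[a', b']`. [folklore] -/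
theorem solution_mono (h : ∀ t ∈ Icc a b, HasDerivWithinAt α (v t (α t)) (Icc a b) t) {a' b' : ℝ}
    (ha : a ≤ a') (hb : b' ≤ b) : ∀ t ∈ Icc a' b', HasDerivWithinAt α (v t (α t)) (Icc a' b') t :=
  IsIntegralCurveOn.mono h (Icc_subset_Icc ha hb)

/-- A function agreeing with a solution on `[a, b]` is a solution on `[a, b]`. [folklore] -/
theorem solution_congr (h : ∀ t ∈ Icc a b, HasDerivWithinAt α (v t (α t)) (Icc a b) t)
    (heq : EqOn β α (Icc a b)) : ∀ t ∈ Icc a b, HasDerivWithinAt β (v t (β t)) (Icc a b) t := by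
  intro t ht
  have h1 := (h t ht).congr heq (heq ht)
  rwa [heq ht]

/-- In the interior a solution on `[a, b]` has a two-sided derivative. [folklore] -/
theorem solution_hasDerivAt (h : ∀ t ∈ Icc a b, HasDerivWithinAt α (v t (α t)) (Icc a b) t) {t : ℝ}
    (ht : t ∈ Ioo a b) : HasDerivAt α (v t (α t)) t :=
  (h t (Ioo_subset_Icc_self ht)).hasDerivAt (Icc_mem_nhds ht.1 ht.2)

/-- At the left endpoint a solution on `[a, b]`, `a < b`, has a right derivative. [folklore] -/
theorem solution_hasDerivWithinAt_Ici
    (h : ∀ t ∈ Icc a b, HasDerivWithinAt α (v t (α t)) (Icc a b) t) (hab : a < b) :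
    HasDerivWithinAt α (v a (α a)) (Ici a) a :=
  (h a (left_mem_Icc.2 hab.le)).mono_of_mem_nhdsWithin (Icc_mem_nhdsGE hab)

/-- The constant function solves any equation on the degenerate interval `[a, a]` (derivatives
within a subsingleton are unconstrained). [folklore] -/
theorem solution_const (v : ℝ → E → E) (a : ℝ) (x : E) :
    ∀ t ∈ Icc a a, HasDerivWithinAt (fun _ : ℝ => x) (v t x) (Icc a a) t := by
  intro t ht
  exact HasFDerivWithinAt.of_subsingleton (subsingleton_Icc_of_ge le_rfl)

/-- **Gluing.** A solution on `[a, b]` and a solution on `[b, c]` that agree at `b` glue to a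
solution on `[a, c]` (one-sided derivatives at `b` with the common value `v b (α b)` combine,
`HasDerivWithinAt.union`). [folklore] -/
theorem solution_append (hα : ∀ t ∈ Icc a b, HasDerivWithinAt α (v t (α t)) (Icc a b) t)
    (hβ : ∀ t ∈ Icc b c, HasDerivWithinAt β (v t (β t)) (Icc b c) t) (hab : a ≤ b) (hbc : b ≤ c)
    (h : α b = β b) :
    ∀ t ∈ Icc a c, HasDerivWithinAt (fun s => if s ≤ b then α s else β s)
      (v t (if t ≤ b then α t else β t)) (Icc a c) t := by
  set γ : ℝ → E := fun t => if t ≤ b then α t else β t with hγ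
  -- on the two closed pieces `γ` is a solution within the piece
  have hleft : ∀ t ∈ Icc a b, HasDerivWithinAt γ (v t (γ t)) (Icc a b) t := by
    intro t ht
    have heq : EqOn γ α (Icc a b) := fun s hs => if_pos hs.2
    have := (hα t ht).congr heq (heq ht)
    rwa [heq ht]
  have hright : ∀ t ∈ Icc b c, HasDerivWithinAt γ (v t (γ t)) (Icc b c) t := by
    intro t ht
    have heq : EqOn γ β (Icc b c) := by
      intro s hs
      by_cases hsb : s ≤ b
      · have hs' : s = b := le_antisymm hsb hs.1
        simp only [hγ, hs', h, ite_self]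
      · exact if_neg hsb
    have := (hβ t ht).congr heq (heq ht)
    rwa [heq ht]
  intro t ht
  show HasDerivWithinAt γ (v t (γ t)) (Icc a c) t
  rcases lt_trichotomy t b with htb | rfl | hbt
  · -- `t < b`: `Iio b` is a neighbourhood of `t`
    have h1 := hleft t ⟨ht.1, htb.le⟩
    rw [← hasDerivWithinAt_inter (Iio_mem_nhds htb)] at h1 ⊢
    exact h1.mono fun s hs => ⟨⟨hs.1.1, hs.2.le⟩, hs.2⟩
  · rw [← Icc_union_Icc_eq_Icc hab hbc]
    exact (hleft t ⟨hab, le_rfl⟩).union (hright t ⟨le_rfl, hbc⟩)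
  · have h1 := hright t ⟨hbt.le, ht.2⟩
    rw [← hasDerivWithinAt_inter (Ioi_mem_nhds hbt)] at h1 ⊢
    exact h1.mono fun s hs => ⟨⟨hs.2.le, hs.1.2⟩, hs.2⟩

omit [NormedAddCommGroup E] [NormedSpace ℝ E] in
/-- The glued function agrees with the first piece on `[a, b]`. [folklore] -/
theorem append_eqOn_left (α β : ℝ → E) (a b : ℝ) :
    EqOn (fun t => if t ≤ b then α t else β t) α (Icc a b) := fun _ ht => if_pos ht.2

end Solutions

/-! ## Continuation with uniform steps -/

section Extend

variable [CompleteSpace E]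

/-- **One Picard–Lindelöf step of uniform length.** If on `[t₀, t₀ + δ] ⊆ [a, T]` the field is
`K`-Lipschitz and bounded by `L` on the ball `‖x‖ ≤ R + 1`, continuous in `t`, and `L δ ≤ 1`, then
from any `x` with `‖x‖ ≤ R` there is a solution on `[t₀, t₁]` for every `t₁ ∈ [t₀, t₀ + δ]`
(Mathlib `IsPicardLindelof` with centre `x`, radius `a = 1`, `r = 0`). [folklore] -/
theorem exists_isSolutionOn_step {v : ℝ → E → E} {t₀ t₁ : ℝ} (ht : t₀ ≤ t₁) {R : ℝ} {K L : ℝ≥0}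
    (hlip : ∀ t ∈ Icc t₀ t₁, LipschitzOnWith K (v t) (closedBall 0 (R + 1)))
    (hcont : ∀ x ∈ closedBall (0 : E) (R + 1), ContinuousOn (v · x) (Icc t₀ t₁))
    (hbdd : ∀ t ∈ Icc t₀ t₁, ∀ x ∈ closedBall (0 : E) (R + 1), ‖v t x‖ ≤ L)
    (hδ : (L : ℝ) * (t₁ - t₀) ≤ 1) {x : E} (hx : ‖x‖ ≤ R) :
    ∃ β : ℝ → E, β t₀ = x ∧ ∀ t ∈ Icc t₀ t₁, HasDerivWithinAt β (v t (β t)) (Icc t₀ t₁) t := by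
  have hball : closedBall x 1 ⊆ closedBall (0 : E) (R + 1) := by
    intro y hy
    rw [mem_closedBall, dist_zero_right]
    rw [mem_closedBall, dist_eq_norm] at hy
    calc ‖y‖ = ‖(y - x) + x‖ := by rw [sub_add_cancel]
      _ ≤ ‖y - x‖ + ‖x‖ := norm_add_le _ _
      _ ≤ 1 + R := add_le_add hy hx
      _ = R + 1 := add_comm _ _
  set T₀ : Icc t₀ t₁ := ⟨t₀, left_mem_Icc.2 ht⟩ with hT₀
  have hPL : IsPicardLindelof v T₀ x 1 0 L K :=
    { lipschitzOnWith := fun t ht' => (hlip t ht').mono hball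
      continuousOn := fun y hy => hcont y (hball hy)
      norm_le := fun t ht' y hy => hbdd t ht' y (hball hy)
      mul_max_le := by
        have h1 : max (t₁ - (T₀ : ℝ)) ((T₀ : ℝ) - t₀) = t₁ - t₀ := by
          rw [hT₀]
          exact max_eq_left (by linarith)
        rw [h1]
        simpa using hδ }
  obtain ⟨β, hβ0, hβ⟩ := hPL.exists_eq_forall_mem_Icc_hasDerivWithinAt (mem_closedBall_self le_rfl)
  exact ⟨β, hβ0, hβ⟩

/-- **Continuation under an a priori bound** (Teschl 2012, Cor. 2.15–2.16; Hale 1980, Ch. I,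
Thm. 2.1; the continuation step "the `c_k^n` do not blow up in finite time and hence `T_n = ∞`"
of Robinson–Rodrigo–Sadowski 2016, Thm. 4.4, Step 2, p. 75). Let `α`
solve `α' = v(t, α)` on `[a, b]`, `b ≤ T`. Suppose that for `t ∈ [a, T]` the field `v t` is
`K`-Lipschitz and bounded by `L` on the ball `‖x‖ ≤ R + 1` and `t ↦ v t x` is continuous there,
and that every solution `β` on `[a, s]`, `b ≤ s ≤ T`, extending `α` satisfies `‖β t‖ ≤ R` on
`[b, s]` (a priori bound). Then `α` extends to a solution on `[a, T]`. Proof: Picard–Lindelöf on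
consecutive intervals of the fixed length `1/(L+1)`, restarting each time inside the a priori
ball, and gluing (`solution_append`). [cite: Teschl2012, Cor. 2.16] -/
theorem solution_extend {v : ℝ → E → E} {a b T : ℝ} (hab : a ≤ b) (hbT : b ≤ T) {α : ℝ → E}
    (hα : ∀ t ∈ Icc a b, HasDerivWithinAt α (v t (α t)) (Icc a b) t) {R : ℝ} {K L : ℝ≥0}
    (hlip : ∀ t ∈ Icc a T, LipschitzOnWith K (v t) (closedBall 0 (R + 1)))
    (hcont : ∀ x ∈ closedBall (0 : E) (R + 1), ContinuousOn (v · x) (Icc a T))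
    (hbdd : ∀ t ∈ Icc a T, ∀ x ∈ closedBall (0 : E) (R + 1), ‖v t x‖ ≤ L)
    (hapriori : ∀ s ∈ Icc b T, ∀ β : ℝ → E,
      (∀ t ∈ Icc a s, HasDerivWithinAt β (v t (β t)) (Icc a s) t) → EqOn β α (Icc a b) →
      ∀ t ∈ Icc b s, ‖β t‖ ≤ R) :
    ∃ β : ℝ → E, (∀ t ∈ Icc a T, HasDerivWithinAt β (v t (β t)) (Icc a T) t) ∧
      EqOn β α (Icc a b) := by
  -- step length
  set δ : ℝ := 1 / ((L : ℝ) + 1) with hδ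
  have hL1 : (0 : ℝ) < (L : ℝ) + 1 := by positivity
  have hδpos : 0 < δ := by rw [hδ]; positivity
  have hLδ : (L : ℝ) * δ ≤ 1 := by
    rw [hδ, mul_one_div, div_le_one hL1]
    linarith
  -- the endpoints of the steps
  set s : ℕ → ℝ := fun j => min (b + j * δ) T with hs
  have hs_mono : ∀ j, s j ≤ s (j + 1) := fun j => by
    simp only [hs]
    refine min_le_min ?_ le_rfl
    push_cast
    nlinarith
  have hbs : ∀ j, b ≤ s j := fun j => by
    simp only [hs]
    refine le_min ?_ hbT
    have : (0 : ℝ) ≤ j * δ := by positivity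
    linarith
  have hsT : ∀ j, s j ≤ T := fun j => min_le_right _ _
  have hstep_len : ∀ j, s (j + 1) - s j ≤ δ := fun j => by
    simp only [hs]
    rcases le_total (b + j * δ) T with h1 | h1
    · rw [min_eq_left h1]
      have : min (b + ((j + 1 : ℕ) : ℝ) * δ) T ≤ b + ((j + 1 : ℕ) : ℝ) * δ := min_le_left _ _
      push_cast at this ⊢
      nlinarith
    · rw [min_eq_right h1, min_eq_right (h1.trans (by push_cast; nlinarith))]
      linarith
  -- induction on the number of steps
  have key : ∀ j : ℕ, ∃ β : ℝ → E,
      (∀ t ∈ Icc a (s j), HasDerivWithinAt β (v t (β t)) (Icc a (s j)) t) ∧ EqOn β α (Icc a b) := by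
    intro j
    induction j with
    | zero =>
      refine ⟨α, ?_, fun _ _ => rfl⟩
      have h0 : s 0 = b := by simp [hs, hbT]
      rw [h0]
      exact hα
    | succ j ih =>
      obtain ⟨β, hβ, hβα⟩ := ih
      -- restart from `β (s j)`, which lies in the a priori ball
      have hR : ‖β (s j)‖ ≤ R :=
        hapriori (s j) ⟨hbs j, hsT j⟩ β hβ hβα (s j) ⟨hbs j, le_rfl⟩
      have hsub : Icc (s j) (s (j + 1)) ⊆ Icc a T :=
        Icc_subset_Icc (hab.trans (hbs j)) (hsT (j + 1))
      obtain ⟨γ, hγ0, hγ⟩ := exists_isSolutionOn_step (hs_mono j) (R := R) (K := K) (L := L)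
        (fun t ht => hlip t (hsub ht)) (fun x hx => (hcont x hx).mono hsub)
        (fun t ht x hx => hbdd t (hsub ht) x hx)
        ((mul_le_mul_of_nonneg_left (hstep_len j) L.coe_nonneg).trans hLδ) hR
      refine ⟨fun t => if t ≤ s j then β t else γ t,
        solution_append hβ hγ (hab.trans (hbs j)) (hs_mono j) hγ0.symm, ?_⟩
      intro t ht
      have hle : t ≤ s j := ht.2.trans (hbs j)
      simp only [if_pos hle, hβα ht]
  -- after enough steps we have reached `T`
  obtain ⟨j, hj⟩ := exists_nat_ge ((T - b) / δ)
  have hsj : s j = T := by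
    simp only [hs]
    refine min_eq_right ?_
    have : T - b ≤ j * δ := by rwa [div_le_iff₀ hδpos] at hj
    linarith
  obtain ⟨β, hβ, hβα⟩ := key j
  exact ⟨β, hsj ▸ hβ, hβα⟩

omit [NormedSpace ℝ E] [CompleteSpace E] in
/-- Local boundedness of the field from the Lipschitz and continuity hypotheses: on
`[a, T] × {‖x‖ ≤ ρ}` a field that is `K`-Lipschitz in `x` and continuous in `t` is bounded
(`‖v t x‖ ≤ ‖v t 0‖ + K ρ`, and `t ↦ v t 0` is bounded on the compact interval). [folklore] -/
theorem exists_bound_of_lipschitzOnWith {v : ℝ → E → E} {a T ρ : ℝ} (hρ : 0 ≤ ρ) {K : ℝ≥0}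
    (hlip : ∀ t ∈ Icc a T, LipschitzOnWith K (v t) (closedBall 0 ρ))
    (hcont : ContinuousOn (v · (0 : E)) (Icc a T)) :
    ∃ L : ℝ≥0, ∀ t ∈ Icc a T, ∀ x ∈ closedBall (0 : E) ρ, ‖v t x‖ ≤ L := by
  obtain ⟨M, hM⟩ := isCompact_Icc.exists_bound_of_continuousOn hcont
  refine ⟨⟨max (M + K * ρ) 0, le_max_right _ _⟩, fun t ht x hx => ?_⟩
  have h0 : (0 : E) ∈ closedBall (0 : E) ρ := mem_closedBall_self hρ
  have h1 : ‖v t x - v t 0‖ ≤ K * ρ := by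
    have := (hlip t ht).norm_sub_le hx h0
    rw [sub_zero] at this
    refine this.trans ?_
    gcongr
    simpa using hx
  have h2 : ‖v t 0‖ ≤ M := hM t ht
  calc ‖v t x‖ = ‖(v t x - v t 0) + v t 0‖ := by rw [sub_add_cancel]
    _ ≤ ‖v t x - v t 0‖ + ‖v t 0‖ := norm_add_le _ _
    _ ≤ K * ρ + M := add_le_add h1 h2
    _ ≤ _ := by
      show (K : ℝ) * ρ + M ≤ ((⟨max (M + K * ρ) 0, le_max_right _ _⟩ : ℝ≥0) : ℝ)
      rw [add_comm]
      exact le_max_left _ _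

/-- **Global existence on `[0, ∞)` from a priori bounds** (Teschl 2012, Cor. 2.16: a solution
with bounded forward orbit on every finite horizon has `T₊ = ∞`; Hale 1980, Ch. I, Thm. 2.1;
Hartman 1964, Ch. II, Thm. 3.1). Let `v : ℝ → E → E` (Banach `E`) be
Lipschitz on every ball `‖x‖ ≤ ρ` uniformly for `t` in each `[0, T]`, with `t ↦ v t x`
continuous on `[0, ∞)` for every `x`. Suppose that for every horizon `T ≥ 0` there is `R` with
`‖x₀‖ ≤ R` such that every solution `α` of `α' = v(t, α)`, `α 0 = x₀`, on any `[0, s] ⊆ [0, T]`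
satisfies `‖α t‖ ≤ R` on `[0, s]`. Then there is `α : ℝ → E` with `α 0 = x₀` solving the equation
on every `[0, T]` (hence `HasDerivAt α (v t (α t)) t` for all `t > 0` and a right derivative at
`0`). Proof: continuation (`solution_extend`) from `[0, m]` to `[0, m + 1]` for every `m ∈ ℕ`
produces a nested sequence of solutions, whose union is the global one. [cite: Teschl2012, Cor. 2.16] -/
theorem exists_solution_of_apriori_bound {v : ℝ → E → E} {x₀ : E}
    (hlip : ∀ T ρ : ℝ, ∃ K : ℝ≥0, ∀ t ∈ Icc 0 T, LipschitzOnWith K (v t) (closedBall 0 ρ))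
    (hcont : ∀ x, ContinuousOn (v · x) (Ici 0))
    (hapriori : ∀ T : ℝ, 0 ≤ T → ∃ R : ℝ, ‖x₀‖ ≤ R ∧ ∀ s ∈ Icc 0 T, ∀ α : ℝ → E, α 0 = x₀ →
      (∀ t ∈ Icc 0 s, HasDerivWithinAt α (v t (α t)) (Icc 0 s) t) → ∀ t ∈ Icc 0 s, ‖α t‖ ≤ R) :
    ∃ α : ℝ → E, α 0 = x₀ ∧ ∀ T, ∀ t ∈ Icc 0 T, HasDerivWithinAt α (v t (α t)) (Icc 0 T) t := by
  -- one continuation step `[0, m] → [0, m + 1]`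
  have step : ∀ (m : ℕ) (β : ℝ → E),
      ((∀ t ∈ Icc 0 (m : ℝ), HasDerivWithinAt β (v t (β t)) (Icc 0 (m : ℝ)) t) ∧ β 0 = x₀) →
      ∃ β' : ℝ → E, ((∀ t ∈ Icc 0 ((m + 1 : ℕ) : ℝ),
        HasDerivWithinAt β' (v t (β' t)) (Icc 0 ((m + 1 : ℕ) : ℝ)) t) ∧ β' 0 = x₀) ∧
        EqOn β' β (Icc 0 m) := by
    rintro m β ⟨hβ, hβ0⟩
    have hm : (0 : ℝ) ≤ m := Nat.cast_nonneg m
    have hm1 : (m : ℝ) ≤ (m + 1 : ℕ) := by exact_mod_cast Nat.le_succ m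
    obtain ⟨R, hx₀R, hR⟩ := hapriori (m + 1 : ℕ) (hm.trans hm1)
    -- enlarge `R` to be nonnegative-plus (not needed: `‖x₀‖ ≤ R` gives `0 ≤ R`)
    have hR0 : 0 ≤ R := (norm_nonneg _).trans hx₀R
    obtain ⟨K, hK⟩ := hlip (m + 1 : ℕ) (R + 1)
    obtain ⟨L, hL⟩ := exists_bound_of_lipschitzOnWith (a := 0) (by linarith) hK
      ((hcont 0).mono Icc_subset_Ici_self)
    obtain ⟨β', hβ', hβ'β⟩ := solution_extend hm hm1 hβ (R := R) (K := K) (L := L) hK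
      (fun x _ => (hcont x).mono Icc_subset_Ici_self) hL
      (fun s hs γ hγ hγβ t ht => hR s ⟨hm.trans hs.1, hs.2⟩ γ
        (by rw [hγβ (left_mem_Icc.2 hm), hβ0]) hγ t ⟨hm.trans ht.1, ht.2⟩)
    exact ⟨β', ⟨hβ', by rw [hβ'β (left_mem_Icc.2 hm), hβ0]⟩, hβ'β⟩
  choose! ext hext using step
  -- the nested sequence of solutions on `[0, m]`
  let sol : ℕ → ℝ → E := fun m => Nat.rec (fun _ => x₀) (fun m β => ext m β) m
  have hsol : ∀ m : ℕ, (∀ t ∈ Icc 0 (m : ℝ), HasDerivWithinAt (sol m) (v t (sol m t))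
      (Icc 0 (m : ℝ)) t) ∧ sol m 0 = x₀ := by
    intro m
    induction m with
    | zero =>
      refine ⟨?_, rfl⟩
      show ∀ t ∈ Icc 0 ((0 : ℕ) : ℝ), HasDerivWithinAt (fun _ : ℝ => x₀) (v t x₀)
        (Icc 0 ((0 : ℕ) : ℝ)) t
      rw [Nat.cast_zero]
      exact solution_const v 0 x₀
    | succ m ih => exact (hext m (sol m) ih).1
  have hnest : ∀ m : ℕ, EqOn (sol (m + 1)) (sol m) (Icc 0 m) := fun m =>
    (hext m (sol m) (hsol m)).2
  have hnest' : ∀ m n : ℕ, m ≤ n → EqOn (sol n) (sol m) (Icc 0 m) := by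
    intro m n hmn
    induction n, hmn using Nat.le_induction with
    | base => exact fun _ _ => rfl
    | succ n hmn ih =>
      intro t ht
      have hmn' : (m : ℝ) ≤ n := by exact_mod_cast hmn
      rw [hnest n ⟨ht.1, ht.2.trans hmn'⟩, ih ht]
  -- the global solution
  refine ⟨fun t => sol (⌈t⌉₊ + 1) t, by simpa using (hsol 1).2, fun T => ?_⟩
  set M : ℕ := ⌈T⌉₊ + 1 with hM
  have hTM : T ≤ M := by
    rw [hM]; push_cast
    have := Nat.le_ceil T
    linarith
  have hsolM : ∀ t ∈ Icc 0 T, HasDerivWithinAt (sol M) (v t (sol M t)) (Icc 0 T) t :=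
    solution_mono (hsol M).1 le_rfl hTM
  refine solution_congr hsolM fun t ht => ?_
  have hle : ⌈t⌉₊ + 1 ≤ M := by
    rw [hM]
    exact Nat.succ_le_succ (Nat.ceil_mono ht.2)
  have htc : t ≤ ((⌈t⌉₊ + 1 : ℕ) : ℝ) := by
    push_cast
    have := Nat.le_ceil t
    linarith
  exact (hnest' _ _ hle ⟨ht.1, htc⟩).symm

/-- The global solution of `exists_solution_of_apriori_bound`, unpacked: `α 0 = x₀`,
`α` is continuous on `[0, ∞)`, has derivative `v t (α t)` at every `t > 0` and right derivative
`v 0 x₀` at `0` within `[0, ∞)`. [folklore] -/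
theorem exists_solution_Ici_of_apriori_bound {v : ℝ → E → E} {x₀ : E}
    (hlip : ∀ T ρ : ℝ, ∃ K : ℝ≥0, ∀ t ∈ Icc 0 T, LipschitzOnWith K (v t) (closedBall 0 ρ))
    (hcont : ∀ x, ContinuousOn (v · x) (Ici 0))
    (hapriori : ∀ T : ℝ, 0 ≤ T → ∃ R : ℝ, ‖x₀‖ ≤ R ∧ ∀ s ∈ Icc 0 T, ∀ α : ℝ → E, α 0 = x₀ →
      (∀ t ∈ Icc 0 s, HasDerivWithinAt α (v t (α t)) (Icc 0 s) t) → ∀ t ∈ Icc 0 s, ‖α t‖ ≤ R) :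
    ∃ α : ℝ → E, α 0 = x₀ ∧ ContinuousOn α (Ici 0) ∧
      (∀ t, 0 ≤ t → HasDerivWithinAt α (v t (α t)) (Ici 0) t) ∧
      ∀ t, 0 < t → HasDerivAt α (v t (α t)) t := by
  obtain ⟨α, hα0, hα⟩ := exists_solution_of_apriori_bound hlip hcont hapriori
  have hmem : ∀ t : ℝ, 0 ≤ t → Icc 0 (t + 1) ∈ 𝓝[Ici 0] t := fun t _ =>
    Filter.mem_of_superset (inter_mem_nhdsWithin (Ici (0 : ℝ)) (Iio_mem_nhds (by linarith)))
      fun s hs => ⟨hs.1, hs.2.le⟩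
  refine ⟨α, hα0, ?_, ?_, ?_⟩
  · intro t ht
    exact (IsIntegralCurveOn.continuousOn (hα (t + 1)) t ⟨ht, by linarith⟩).mono_of_mem_nhdsWithin
      (hmem t ht)
  · intro t ht
    exact ((hα (t + 1)) t ⟨ht, by linarith⟩).mono_of_mem_nhdsWithin (hmem t ht)
  · intro t ht
    exact solution_hasDerivAt (hα (t + 1)) ⟨ht, by linarith⟩

end Extend

end Literature.Analysis.ODE
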